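import Literature.Analysis.OperatorTheory.Enflo2023.Lemma1Lever
import Literature.Analysis.OperatorTheory.Enflo2023.Lemma1Standing
import Literature.Analysis.OperatorTheory.Enflo2023.TypeDichotomy
import HarnessLib

/-!
# Enflo (2023), Lemma 1 in the manuscript's own regime `(εθ)₀ ≪ δ_k`: the printed choice of `u₁` still fails

P. H. Enflo, *On the invariant subspace problem in Hilbert spaces*, arXiv:2305.15442v2, pp. 6–9 and p. 20.

**What this file adds to `Lemma1Model` / `Lemma1Standing`.**  Those counter-models to the printed Lemma 1 hard-wire
`‖T*u₁‖ = 10⁻²⁰ = ‖T‖` (`Tu₀ = 10⁻²⁰u₁`), so they refute the printed statement only for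
`(εθ)₀ ∈ (10⁻²⁰, 1.72·10⁻¹⁵)`, and the positive result `Lemma1.lemma1_printed_of_ge` needs `(εθ)₀ ≥ 8·10⁻¹⁵`.  Both ranges lie OUTSIDE the regime in which the manuscript uses Lemma 1: p. 8 ("(εθ) is chosen
much smaller than these numbers", the `δ_k` of (19), and `δ_k ≤ ‖T‖^k = 10⁻²⁰ᵏ`) and p. 20 ("δ₁ and δ₂ … of larger
order of magnitude than both εθ and [the functions of εθ]").  Here the printed Lemma 1 is refuted INSIDE that regime:
for every `0 < (εθ)₀ ≤ 2·10⁻²⁴` — so for `(εθ)₀` as small as one likes against FIXED Type-1 constants `δ_n`.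

**The family.**  On `ℓ²(ℕ)` let `q = 10⁻²⁰` and, for `0 ≤ μ ≤ 10⁻²⁴`,
  `T_μ = [[q/2, μ],[μ, 0]]` on `span{e₀, e₁}`  `⊕ diag(2q/(k+2))_{k ≥ 0}` on `span{e₂, e₃, …}`      (`Treg μ`).
Then `‖T_μ‖ = q` (attained at `e₂`; `norm_Treg`), `T_μ` is injective (`μ ≠ 0`), self-adjoint, with dense, non-closed
range (`Treg_injective`, `Treg_isSelfAdjoint`, `Treg_denseRange`, `Treg_not_surjective`) — the standing form of v2 p. 1 —
and `T_μ e₀ = (q/2)e₀ + μe₁`, `T_μ* e₁ = T_μ e₁ = μe₀` (`Treg_e0`, `adjoint_Treg_e1`), so with `u₀ = e₀`, `u₁ = e₁`: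
  `‖T*u₁‖ = μ`   and the LEVER of `Lemma1Lever` is `⟨u₁, Tu₀⟩ = μ` (no garbage: `g = 0`, `n₀ = q/2`).
**Type 1 via `e₀`, uniformly in `μ`** (`Treg_cone_bound`, `Treg_type1`): writing `T_μⁿ|span{e₀,e₁} = [[p_n, r_n],[r_n, s_n]]`
(`P`, `iterate_apply_head`; `p_n ≥ (q/2)ⁿ`, `0 ≤ r_n ≤ (2μ/q)p_n ≤ 2·10⁻⁴p_n`, `s_n ≥ 0`, `P_bounds`), for `y` in the
cone `Re y₀ ≥ ‖y‖/100` one has `Re⟨T_μⁿy, y⟩ ≥ p_n|y₀|² − 2r_n|y₀||y₁| ≥ 0.96p_n|y₀|² ≥ 9·10⁻⁵(q/2)ⁿ‖y‖²`, i.e. (19)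
holds with `j = n` and `δ_n = 9·10⁻⁵(5·10⁻²¹)ⁿ`, INDEPENDENT of `μ`.
**Failure of the printed Lemma 1** (`printed_lemma1_fails_Treg`, from `Lemma1.printed_lemma1_fails_of_lever` with
`n₀ = q/2`, `m₁ = μ`, `(εθ)₀ = 2μ ≤ 4|m₁|`): for `μ = (εθ)₀/2` the printed requirement `‖T*u₁‖ = (εθ)₀/2 < (εθ)₀`
holds and at EVERY radius `ε ∈ (½ − 10⁻⁵(εθ)₀, ½]` the minimiser has `εθ(ℓ'_ε) > ½·10⁻⁵(εθ)₀` (indeed `≥ 0.12(εθ)₀`).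
Packaged: `printed_lemma1_fails_in_regime` (every `(εθ)₀ ∈ (0, 2·10⁻²⁴]`) and the instance
`printed_lemma1_fails_regime_instance` (`(εθ)₀ = 10⁻⁶⁰ ≪ δ₂ = 2.25·10⁻⁴⁵ ≪ δ₁ = 4.5·10⁻²⁵`).
So the defect of the printed choice of `u₁` (it bounds `‖T*u₁‖` by `(εθ)₀` where the argument needs the single
coefficient `|⟨T*u₁, u₀⟩| ≲ 2·10⁻⁵(εθ)₀`, `Lemma1Lever`) is not an artefact of taking `(εθ)₀` comparable with `‖T‖`:
it persists for `(εθ)₀ → 0` with the Type-1 data fixed, exactly the limit the manuscript works in.  The REPAIRED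
Lemma 1 (`Lemma1.lemma1_repaired`: `‖T*u₁‖ ≤ 1.25·10⁻⁶(εθ)₀`, available for cyclic `u₀` by `Lemma1.exists_unit_orthogonal_adjoint_le`)
is unaffected.
Why the model is shaped like this: the cheap way to meet `‖T*u₁‖ < (εθ)₀` for every `(εθ)₀` — `u₁` orthogonal to
the whole orbit of `u₀` (`V*u₁ = 0`, e.g. `u₁` in a reducing subspace not containing `u₀`) — is no counter-model:
then `‖x₀ − Va‖² = ‖y₀' − Va‖² + ¼`, the distance `½` from `x₀` to `range V` is attained only at `Va = y₀'`, and at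
`ε = ½` (a radius of every window) the minimiser has `εθ = Re⟨½u₁, y₀'⟩ = 0`, so the printed Lemma 1 holds
trivially.  The lever `⟨T*u₁, u₀⟩` must stay a fixed fraction of `(εθ)₀` with `u₁` reachable, which forces `T` itself
to depend on `(εθ)₀`; here `T_μ*u₁ = μu₀` exactly and even `x₀ = Vb`, `b = (1 − n₀/(√3m₁))e₀ + (1/(√3m₁))e₁` (cf.
`Lemma1.norm_minimal_le_of_lever`).  Not modelled: cyclicity of `u₀` (`span{e₀, e₁}` reduces `T_μ`), as in
`Lemma1Standing`.
Origin: planner-b2b-enflo-1-g11-0 (formaliser 1, gen 11), 2026-08-19.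
-/

noncomputable section

open scoped InnerProductSpace ENNReal
open ContinuousLinearMap

namespace Literature.Analysis.OperatorTheory.Enflo2023

namespace Lemma1

namespace Regime

open Vy

/-! ### The unit vectors `e_k` of `ℓ²(ℕ)`
We reuse `e k = lp.single 2 k 1` and its four elementary lemmas from `Lemma1Standing` (landed). -/

open Literature.Analysis.OperatorTheory.Enflo2023.Lemma1.Standing (e e_apply norm_e inner_e_left inner_e0_e1)
open Literature.Analysis.UnboundedOperators (inner_self_eq_coe_norm_sq)

/-! ### The block family `T_μ = [[q/2, μ],[μ, 0]] ⊕ diag(2q/(k+2))` on `ℓ²(ℕ)`, `q = 10⁻²⁰` -/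

/-- Tail weights `w_k = 2·10⁻²⁰/(k+2)` (the weight of the coordinate `k+2`; `w₀ = 10⁻²⁰ = ‖T‖`). [folklore] -/
def wt (k : ℕ) : ℝ := 2 / 10 ^ 20 / ((k : ℝ) + 2)

/-- The tail weights satisfy `0 < w_k ≤ 10⁻²⁰`. [folklore] -/
lemma wt_bounds (k : ℕ) : 0 < wt k ∧ wt k ≤ 1 / 10 ^ 20 := by
  refine ⟨by unfold wt; positivity, ?_⟩
  unfold wt
  rw [div_le_iff₀ (by positivity)]
  have : (0 : ℝ) ≤ k := Nat.cast_nonneg k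
  nlinarith

/-- `w₀ = 10⁻²⁰`. [folklore] -/
@[simp] lemma wt_zero : wt 0 = 1 / 10 ^ 20 := by unfold wt; norm_num

/-- The coordinate action of `T_μ`: `(Tf)₀ = (q/2)f₀ + μf₁`, `(Tf)₁ = μf₀`, `(Tf)_{k+2} = w_k f_{k+2}`. [folklore] -/
def Tseq (μ : ℝ) (f : ℕ → ℂ) : ℕ → ℂ
  | 0 => ((1 / 10 ^ 20 / 2 : ℝ) : ℂ) * f 0 + (μ : ℂ) * f 1
  | 1 => (μ : ℂ) * f 0
  | (k + 2) => (wt k : ℂ) * f (k + 2)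

/-- `(Tf)₀ = (q/2)f₀ + μf₁`. [folklore] -/
@[simp] lemma Tseq_zero (μ : ℝ) (f : ℕ → ℂ) :
    Tseq μ f 0 = ((1 / 10 ^ 20 / 2 : ℝ) : ℂ) * f 0 + (μ : ℂ) * f 1 := rfl

/-- `(Tf)₁ = μf₀`. [folklore] -/
@[simp] lemma Tseq_one (μ : ℝ) (f : ℕ → ℂ) : Tseq μ f 1 = (μ : ℂ) * f 0 := rfl

/-- `(Tf)_{k+2} = w_k f_{k+2}`. [folklore] -/
@[simp] lemma Tseq_add_two (μ : ℝ) (f : ℕ → ℂ) (k : ℕ) : Tseq μ f (k + 2) = (wt k : ℂ) * f (k + 2) := rfl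

/-- Tail terms are dominated: `‖(Tf)_{k+2}‖² ≤ 10⁻⁴⁰‖f_{k+2}‖²`. [folklore] -/
lemma norm_Tseq_add_two_sq_le (μ : ℝ) (f : ℕ → ℂ) (k : ℕ) :
    ‖Tseq μ f (k + 2)‖ ^ 2 ≤ (1 / 10 ^ 20) ^ 2 * ‖f (k + 2)‖ ^ 2 := by
  rw [Tseq_add_two, norm_mul, mul_pow, Complex.norm_real, Real.norm_of_nonneg (wt_bounds k).1.le]
  exact mul_le_mul_of_nonneg_right (pow_le_pow_left₀ (wt_bounds k).1.le (wt_bounds k).2 2) (by positivity)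

/-- Head terms, crude: `‖(Tf)₀‖² + ‖(Tf)₁‖² ≤ (q + 2|μ|)²(‖f₀‖² + ‖f₁‖²)`. [folklore] -/
lemma head_sq_le_crude (μ : ℝ) (f : ℕ → ℂ) :
    ‖Tseq μ f 0‖ ^ 2 + ‖Tseq μ f 1‖ ^ 2 ≤ (1 / 10 ^ 20 + 2 * |μ|) ^ 2 * (‖f 0‖ ^ 2 + ‖f 1‖ ^ 2) := by
  have h0 : ‖Tseq μ f 0‖ ≤ 1 / 10 ^ 20 / 2 * ‖f 0‖ + |μ| * ‖f 1‖ := by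
    rw [Tseq_zero]
    refine (norm_add_le _ _).trans (le_of_eq ?_)
    rw [norm_mul, norm_mul, Complex.norm_real, Complex.norm_real, Real.norm_of_nonneg (by positivity),
      Real.norm_eq_abs]
  have h1 : ‖Tseq μ f 1‖ = |μ| * ‖f 0‖ := by rw [Tseq_one, norm_mul, Complex.norm_real, Real.norm_eq_abs]
  have hA := norm_nonneg (f 0)
  have hB := norm_nonneg (f 1)
  have hμ := abs_nonneg μ
  have hT0 := norm_nonneg (Tseq μ f 0)
  nlinarith [mul_nonneg hμ hA, mul_nonneg hμ hB, mul_nonneg hA hB, sq_nonneg (‖f 0‖ - ‖f 1‖)]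

/-- Head terms, sharp, for `0 ≤ μ ≤ 10⁻²⁴`: `‖(Tf)₀‖² + ‖(Tf)₁‖² ≤ q²(‖f₀‖² + ‖f₁‖²)`. [folklore] -/
lemma head_sq_le (μ : ℝ) (hμ0 : 0 ≤ μ) (hμ1 : μ ≤ 1 / 10 ^ 24) (f : ℕ → ℂ) :
    ‖Tseq μ f 0‖ ^ 2 + ‖Tseq μ f 1‖ ^ 2 ≤ (1 / 10 ^ 20) ^ 2 * (‖f 0‖ ^ 2 + ‖f 1‖ ^ 2) := by
  have hA := norm_nonneg (f 0)
  have hB := norm_nonneg (f 1)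
  have hT0 := norm_nonneg (Tseq μ f 0)
  have h0 : ‖Tseq μ f 0‖ ≤ 1 / 10 ^ 20 / 2 * ‖f 0‖ + μ * ‖f 1‖ := by
    rw [Tseq_zero]
    refine (norm_add_le _ _).trans (le_of_eq ?_)
    rw [norm_mul, norm_mul, Complex.norm_real, Complex.norm_real, Real.norm_of_nonneg (by positivity),
      Real.norm_of_nonneg hμ0]
  have h0sq : ‖Tseq μ f 0‖ ^ 2 ≤ (1 / 10 ^ 20 / 2 * ‖f 0‖ + μ * ‖f 1‖) ^ 2 := pow_le_pow_left₀ hT0 h0 2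
  have h1sq : ‖Tseq μ f 1‖ ^ 2 = (μ * ‖f 0‖) ^ 2 := by
    rw [Tseq_one, norm_mul, Complex.norm_real, Real.norm_of_nonneg hμ0]
  have hμA : μ * ‖f 0‖ ≤ 1 / 10 ^ 24 * ‖f 0‖ := mul_le_mul_of_nonneg_right hμ1 hA
  have hμB : μ * ‖f 1‖ ≤ 1 / 10 ^ 24 * ‖f 1‖ := mul_le_mul_of_nonneg_right hμ1 hB
  have e1 : (μ * ‖f 0‖) ^ 2 ≤ (1 / 10 ^ 24 * ‖f 0‖) ^ 2 := pow_le_pow_left₀ (by positivity) hμA 2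
  have e2 : (μ * ‖f 1‖) ^ 2 ≤ (1 / 10 ^ 24 * ‖f 1‖) ^ 2 := pow_le_pow_left₀ (by positivity) hμB 2
  have e3 : ‖f 0‖ * (μ * ‖f 1‖) ≤ ‖f 0‖ * (1 / 10 ^ 24 * ‖f 1‖) := mul_le_mul_of_nonneg_left hμB hA
  rw [h1sq]
  nlinarith [sq_nonneg (‖f 0‖ - ‖f 1‖)]

/-- The image sequence is square-summable. [folklore] -/
lemma memℓp_Tseq (μ : ℝ) (f : ℓ2) : Memℓp (Tseq μ f) 2 := by
  rw [memℓp_gen_iff (by norm_num : 0 < (2 : ℝ≥0∞).toReal)]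
  simp only [ENNReal.toReal_ofNat, Real.rpow_two]
  rw [← summable_nat_add_iff 2]
  have hs : Summable (fun k => ‖f (k + 2)‖ ^ 2) := (summable_nat_add_iff 2).2 (summable_sq f)
  refine Summable.of_nonneg_of_le (fun k => by positivity) (fun k => ?_) (hs.mul_left ((1 / 10 ^ 20) ^ 2))
  exact norm_Tseq_add_two_sq_le μ f k

/-- `T_μ` as a linear map. [folklore] -/
def TRlin (μ : ℝ) : ℓ2 →ₗ[ℂ] ℓ2 where
  toFun f := ⟨Tseq μ f, memℓp_Tseq μ f⟩
  map_add' f g := by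
    apply lp.ext
    funext k
    match k with
    | 0 => simp only [Tseq_zero, lp.coeFn_add, Pi.add_apply]; ring
    | 1 => simp only [Tseq_one, lp.coeFn_add, Pi.add_apply]; ring
    | k + 2 => simp only [Tseq_add_two, lp.coeFn_add, Pi.add_apply]; ring
  map_smul' c f := by
    apply lp.ext
    funext k
    match k with
    | 0 => simp only [Tseq_zero, lp.coeFn_smul, Pi.smul_apply, smul_eq_mul, RingHom.id_apply]; ring
    | 1 => simp only [Tseq_one, lp.coeFn_smul, Pi.smul_apply, smul_eq_mul, RingHom.id_apply]; ring
    | k + 2 => simp only [Tseq_add_two, lp.coeFn_smul, Pi.smul_apply, smul_eq_mul, RingHom.id_apply]; ring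

/-- Coordinates of the linear map. [folklore] -/
lemma TRlin_apply (μ : ℝ) (f : ℓ2) (k : ℕ) : (TRlin μ f) k = Tseq μ f k := rfl

/-- `Σ_k ‖g_k‖² = ‖g₀‖² + ‖g₁‖² + Σ_k ‖g_{k+2}‖²` for `g ∈ ℓ²`. [folklore] -/
lemma tsum_sq_split (g : ℓ2) :
    ∑' k, ‖g k‖ ^ 2 = ‖g 0‖ ^ 2 + ‖g 1‖ ^ 2 + ∑' k, ‖g (k + 2)‖ ^ 2 := by
  have h := (summable_sq g).sum_add_tsum_nat_add 2
  rw [Finset.sum_range_succ, Finset.sum_range_one] at h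
  linarith

/-- The generic norm estimate: if the head is bounded by `M²(‖f₀‖² + ‖f₁‖²)` with `M ≥ 10⁻²⁰`, then
`‖T_μ f‖ ≤ M‖f‖`. [folklore] -/
lemma norm_TRlin_le_of_head (μ : ℝ) {M : ℝ} (hM : 1 / 10 ^ 20 ≤ M) (f : ℓ2)
    (hhead : ‖Tseq μ f 0‖ ^ 2 + ‖Tseq μ f 1‖ ^ 2 ≤ M ^ 2 * (‖f 0‖ ^ 2 + ‖f 1‖ ^ 2)) :
    ‖TRlin μ f‖ ≤ M * ‖f‖ := by
  have hM0 : 0 ≤ M := le_trans (by norm_num) hM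
  have h1 := norm_sq_eq_tsum (TRlin μ f)
  have h2 := norm_sq_eq_tsum f
  rw [tsum_sq_split] at h1 h2
  simp only [TRlin_apply] at h1
  have hs : Summable (fun k => ‖f (k + 2)‖ ^ 2) := (summable_nat_add_iff 2).2 (summable_sq f)
  have htail : ∑' k, ‖Tseq μ f (k + 2)‖ ^ 2 ≤ ∑' k, M ^ 2 * ‖f (k + 2)‖ ^ 2 := by
    refine Summable.tsum_le_tsum (fun k => ?_) ((summable_nat_add_iff 2).2 (summable_sq (TRlin μ f)))
      (hs.mul_left _)
    exact (norm_Tseq_add_two_sq_le μ f k).trans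
      (mul_le_mul_of_nonneg_right (pow_le_pow_left₀ (by norm_num) hM 2) (by positivity))
  rw [tsum_mul_left] at htail
  have h3 : ‖TRlin μ f‖ ^ 2 ≤ (M * ‖f‖) ^ 2 := by
    rw [h1, mul_pow, h2]
    nlinarith [htail, hhead]
  exact (pow_le_pow_iff_left₀ (norm_nonneg _) (by positivity) two_ne_zero).1 h3

/-- Crude bound `‖T_μ f‖ ≤ (q + 2|μ|)‖f‖`, valid for every `μ`. [folklore] -/
lemma norm_TRlin_le (μ : ℝ) (f : ℓ2) : ‖TRlin μ f‖ ≤ (1 / 10 ^ 20 + 2 * |μ|) * ‖f‖ :=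
  norm_TRlin_le_of_head μ (by have := abs_nonneg μ; linarith) f (head_sq_le_crude μ f)

/-- **The block operator `T_μ`** = `[[10⁻²⁰/2, μ],[μ, 0]]` on `span{e₀,e₁}` `⊕ diag(2·10⁻²⁰/(k+2))_{k≥0}` on the rest.
[cite: Enflo2023, v2 p.1 (standing form), test operator] -/
def Treg (μ : ℝ) : ℓ2 →L[ℂ] ℓ2 := (TRlin μ).mkContinuous (1 / 10 ^ 20 + 2 * |μ|) (norm_TRlin_le μ)

/-- Coordinates of `T_μ`. [folklore] -/
@[simp] lemma Treg_apply (μ : ℝ) (f : ℓ2) (k : ℕ) : (Treg μ f) k = Tseq μ f k := rfl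

/-- `T_μ e₀ = (q/2)e₀ + μe₁`. [cite: Enflo2023, v2 p.7, test operator] -/
lemma Treg_e0 (μ : ℝ) : Treg μ (e 0) = ((1 / 10 ^ 20 / 2 : ℝ) : ℂ) • e 0 + (μ : ℂ) • e 1 := by
  apply lp.ext
  funext k
  simp only [lp.coeFn_add, lp.coeFn_smul, Pi.add_apply, Pi.smul_apply, smul_eq_mul, Treg_apply]
  match k with
  | 0 => simp [e_apply]
  | 1 => simp [e_apply]
  | k + 2 => simp [e_apply]

/-- `T_μ e₁ = μe₀`. [cite: Enflo2023, v2 p.7, test operator] -/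
lemma Treg_e1 (μ : ℝ) : Treg μ (e 1) = (μ : ℂ) • e 0 := by
  apply lp.ext
  funext k
  simp only [lp.coeFn_smul, Pi.smul_apply, smul_eq_mul, Treg_apply]
  match k with
  | 0 => simp [e_apply]
  | 1 => simp [e_apply]
  | k + 2 => simp [e_apply]

/-- `T_μ e₂ = 10⁻²⁰ e₂` (the norm is attained on the tail). [folklore] -/
lemma Treg_e2 (μ : ℝ) : Treg μ (e 2) = ((1 / 10 ^ 20 : ℝ) : ℂ) • e 2 := by
  apply lp.ext
  funext k
  simp only [lp.coeFn_smul, Pi.smul_apply, smul_eq_mul, Treg_apply]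
  match k with
  | 0 => simp [e_apply]
  | 1 => simp [e_apply]
  | 2 => simp [e_apply]
  | k + 3 => simp [e_apply]

/-- `‖T_μ‖ = 10⁻²⁰` for `0 ≤ μ ≤ 10⁻²⁴`. [cite: Enflo2023, v2 p.1 (‖T‖ = 10⁻²⁰ after scaling)] -/
lemma norm_Treg (μ : ℝ) (hμ0 : 0 ≤ μ) (hμ1 : μ ≤ 1 / 10 ^ 24) : ‖Treg μ‖ = 1 / 10 ^ 20 := by
  refine le_antisymm (opNorm_le_bound _ (by norm_num) fun f => ?_) ?_
  · exact norm_TRlin_le_of_head μ le_rfl f (head_sq_le μ hμ0 hμ1 f)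
  · have h1 := (Treg μ).le_opNorm (e 2)
    rw [Treg_e2, norm_smul, norm_e, Complex.norm_real, Real.norm_of_nonneg (by norm_num), mul_one,
      mul_one] at h1
    exact h1

/-- `‖T_μ‖ < 1`. [folklore] -/
lemma norm_Treg_lt_one (μ : ℝ) (hμ0 : 0 ≤ μ) (hμ1 : μ ≤ 1 / 10 ^ 24) : ‖Treg μ‖ < 1 := by
  rw [norm_Treg μ hμ0 hμ1]; norm_num

/-- `T_μ` is injective for `μ ≠ 0` (`det [[q/2, μ],[μ, 0]] = −μ² ≠ 0`, tail weights `> 0`). [cite: Enflo2023, v2 p.1 ("one-to-one")] -/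
lemma Treg_injective (μ : ℝ) (hμ : μ ≠ 0) : Function.Injective (Treg μ) := by
  refine (injective_iff_map_eq_zero _).2 (fun f hf => ?_)
  have hk : ∀ k, Tseq μ f k = 0 := fun k => by
    have := congrArg (fun g : ℓ2 => g k) hf
    simpa using this
  have hμC : (μ : ℂ) ≠ 0 := Complex.ofReal_ne_zero.2 hμ
  have h0 : f 0 = 0 := by
    have := hk 1
    rw [Tseq_one, mul_eq_zero] at this
    exact this.resolve_left hμC
  have h1 : f 1 = 0 := by
    have := hk 0
    rw [Tseq_zero, h0, mul_zero, zero_add, mul_eq_zero] at this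
    exact this.resolve_left hμC
  apply lp.ext
  funext k
  rcases k with _ | _ | k
  · simpa using h0
  · simpa using h1
  · have := hk (k + 2)
    rw [Tseq_add_two, mul_eq_zero] at this
    simpa using this.resolve_left (Complex.ofReal_ne_zero.2 (wt_bounds k).1.ne')

/-- `Σ_k u_k = u₀ + u₁ + Σ_k u_{k+2}` for a summable complex sequence. [folklore] -/
lemma tsum_split_two {u : ℕ → ℂ} (hu : Summable u) : ∑' k, u k = u 0 + u 1 + ∑' k, u (k + 2) := by
  have h := hu.sum_add_tsum_nat_add 2
  rw [Finset.sum_range_succ, Finset.sum_range_one] at h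
  linear_combination -h

/-- `T_μ` is self-adjoint (a real symmetric block plus a real diagonal). [folklore] -/
lemma Treg_isSelfAdjoint (μ : ℝ) : IsSelfAdjoint (Treg μ) := by
  rw [ContinuousLinearMap.isSelfAdjoint_iff_isSymmetric]
  intro f g
  change ⟪Treg μ f, g⟫_ℂ = ⟪f, Treg μ g⟫_ℂ
  rw [lp.inner_eq_tsum, lp.inner_eq_tsum, tsum_split_two (lp.summable_inner (𝕜 := ℂ) _ _),
    tsum_split_two (lp.summable_inner (𝕜 := ℂ) _ _)]
  have htail : ∑' k, ⟪(Treg μ f) (k + 2), g (k + 2)⟫_ℂ = ∑' k, ⟪f (k + 2), (Treg μ g) (k + 2)⟫_ℂ := by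
    congr 1; funext k
    rw [Treg_apply, Treg_apply, Tseq_add_two, Tseq_add_two, RCLike.inner_apply', RCLike.inner_apply', map_mul,
      Complex.conj_ofReal]
    ring
  rw [htail]
  simp only [Treg_apply, Tseq_zero, Tseq_one, RCLike.inner_apply', map_mul, map_add, Complex.conj_ofReal]
  ring

/-- `T_μ` is NOT surjective: `(0, 0, w₀, w₁, …) ∈ ℓ²` has the non-`ℓ²` preimage `(0, 0, 1, 1, …)`. [cite: Enflo2023, v2 p.1 ("the range of T is not closed")] -/
lemma Treg_not_surjective (μ : ℝ) : ¬ Function.Surjective (Treg μ) := by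
  have hmem : Memℓp (fun k : ℕ => ((if 2 ≤ k then wt (k - 2) else 0 : ℝ) : ℂ)) 2 := by
    rw [memℓp_gen_iff (by norm_num : 0 < (2 : ℝ≥0∞).toReal)]
    simp only [ENNReal.toReal_ofNat, Real.rpow_two, Complex.norm_real, Real.norm_eq_abs, sq_abs]
    rw [← summable_nat_add_iff 2]
    have hs : Summable (fun n : ℕ => 1 / ((n : ℝ) + 2) ^ 2) := by
      have := (summable_nat_add_iff 2).mpr (Real.summable_one_div_nat_pow.mpr one_lt_two)
      simpa [Nat.cast_add] using this
    refine Summable.of_nonneg_of_le (fun k => sq_nonneg _) (fun k => ?_) (hs.mul_left ((2 / 10 ^ 20) ^ 2))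
    simp only [le_add_iff_nonneg_left, zero_le, ↓reduceIte, Nat.add_sub_cancel]
    have hw : wt k = 2 / 10 ^ 20 * (1 / ((k : ℝ) + 2)) := by unfold wt; ring
    rw [hw, mul_pow, one_div_pow]
  intro hsurj
  obtain ⟨f, hf⟩ := hsurj ⟨_, hmem⟩
  have hk : ∀ k, f (k + 2) = 1 := by
    intro k
    have h := congrArg (fun g : ℓ2 => g (k + 2)) hf
    simp only [Treg_apply, Tseq_add_two, le_add_iff_nonneg_left, zero_le, ↓reduceIte,
      Nat.add_sub_cancel] at h
    have hd : (wt k : ℂ) ≠ 0 := Complex.ofReal_ne_zero.mpr (wt_bounds k).1.ne'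
    have h' : (wt k : ℂ) * f (k + 2) = (wt k : ℂ) * 1 := by rw [mul_one]; exact h
    exact mul_left_cancel₀ hd h'
  have ht := ((summable_nat_add_iff 2).2 (summable_sq f)).tendsto_atTop_zero
  simp only [hk, norm_one, one_pow] at ht
  exact zero_ne_one (tendsto_nhds_unique ht tendsto_const_nhds)

/-- `T_μ` has dense range (self-adjoint and injective), `μ ≠ 0`. [cite: Enflo2023, v2 p.1 ("dense range")] -/
lemma Treg_denseRange (μ : ℝ) (hμ : μ ≠ 0) : DenseRange (Treg μ) := by
  have hker : LinearMap.ker (Treg μ : ℓ2 →ₗ[ℂ] ℓ2) = ⊥ :=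
    LinearMap.ker_eq_bot.mpr (by exact Treg_injective μ hμ)
  have h1 := (Treg μ).orthogonal_ker
  rw [hker, Submodule.bot_orthogonal_eq_top,
    ContinuousLinearMap.isSelfAdjoint_iff'.1 (Treg_isSelfAdjoint μ)] at h1
  have h2 : Dense ((LinearMap.range (Treg μ : ℓ2 →ₗ[ℂ] ℓ2) : Submodule ℂ ℓ2) : Set ℓ2) :=
    Submodule.dense_iff_topologicalClosure_eq_top.mpr h1.symm
  have h3 : ((LinearMap.range (Treg μ : ℓ2 →ₗ[ℂ] ℓ2) : Submodule ℂ ℓ2) : Set ℓ2) = Set.range (Treg μ) := by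
    ext x
    simp only [SetLike.mem_coe, LinearMap.mem_range, Set.mem_range, ContinuousLinearMap.coe_coe]
  rw [h3] at h2
  exact h2

/-- `T_μ* e₁ = μe₀`, so `‖T_μ* u₁‖ = μ` for `u₁ = e₁`. [cite: Enflo2023, v2 p.7, choice of u₁] -/
lemma adjoint_Treg_e1 (μ : ℝ) : adjoint (Treg μ) (e 1) = (μ : ℂ) • e 0 := by
  rw [ContinuousLinearMap.isSelfAdjoint_iff'.1 (Treg_isSelfAdjoint μ), Treg_e1]

/-- `‖T_μ* e₁‖ = μ` (`μ ≥ 0`). [cite: Enflo2023, v2 p.7, choice of u₁] -/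
lemma norm_adjoint_Treg_e1 (μ : ℝ) (hμ0 : 0 ≤ μ) : ‖adjoint (Treg μ) (e 1)‖ = μ := by
  rw [adjoint_Treg_e1, norm_smul, norm_e, Complex.norm_real, Real.norm_of_nonneg hμ0, mul_one]

/-! ### Powers of `T_μ` on `span{e₀, e₁}` and the Type-1 property via `e₀`, uniformly in `μ` -/

/-- `P_n = (p_n, r_n, s_n)`: `T_μⁿ` acts on `span{e₀,e₁}` by the symmetric matrix `[[p_n, r_n],[r_n, s_n]]`;
`P₀ = (1, 0, 1)`, `P_{n+1} = ((q/2)p_n + μr_n, μp_n, μr_n)`. [folklore] -/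
def P (μ : ℝ) : ℕ → ℝ × ℝ × ℝ
  | 0 => (1, 0, 1)
  | n + 1 => (1 / 10 ^ 20 / 2 * (P μ n).1 + μ * (P μ n).2.1, μ * (P μ n).1, μ * (P μ n).2.1)

/-- `P₀ = (1, 0, 1)`. [folklore] -/
@[simp] lemma P_zero (μ : ℝ) : P μ 0 = (1, 0, 1) := rfl

/-- The recursion for `P_{n+1}`. [folklore] -/
lemma P_succ (μ : ℝ) (n : ℕ) :
    P μ (n + 1) = (1 / 10 ^ 20 / 2 * (P μ n).1 + μ * (P μ n).2.1, μ * (P μ n).1, μ * (P μ n).2.1) := rfl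

/-- The symmetry identity `(q/2)r_n + μs_n = μp_n` (both sides are the off-diagonal entry of `B^{n+1}`). [folklore] -/
lemma P_sym (μ : ℝ) (n : ℕ) : 1 / 10 ^ 20 / 2 * (P μ n).2.1 + μ * (P μ n).2.2 = μ * (P μ n).1 := by
  rcases n with _ | n
  · simp
  · rw [P_succ]; ring

/-- Sign and size of the entries: `p_n ≥ (q/2)ⁿ`, `0 ≤ r_n ≤ (2μ/q)p_n`, `s_n ≥ 0` (`μ ≥ 0`). [folklore] -/
lemma P_bounds (μ : ℝ) (hμ0 : 0 ≤ μ) : ∀ n : ℕ,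
    (1 / 10 ^ 20 / 2) ^ n ≤ (P μ n).1 ∧ 0 ≤ (P μ n).2.1 ∧
      (P μ n).2.1 * (1 / 10 ^ 20 / 2) ≤ μ * (P μ n).1 ∧ 0 ≤ (P μ n).2.2
  | 0 => by simp only [P_zero]; exact ⟨by norm_num, le_rfl, by simpa using hμ0, zero_le_one⟩
  | n + 1 => by
      obtain ⟨h1, h2, h3, h4⟩ := P_bounds μ hμ0 n
      rw [P_succ]
      have hq : (0 : ℝ) < (1 / 10 ^ 20 / 2) ^ n := by positivity
      have hp : 0 ≤ (P μ n).1 := hq.le.trans h1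
      refine ⟨?_, mul_nonneg hμ0 hp, ?_, mul_nonneg hμ0 h2⟩
      · rw [pow_succ]; nlinarith [mul_nonneg hμ0 h2]
      · nlinarith [mul_nonneg (mul_nonneg hμ0 hμ0) h2]

/-- Head coordinates of the iterates: `(Tⁿf)₀ = p_n f₀ + r_n f₁`, `(Tⁿf)₁ = r_n f₀ + s_n f₁`. [folklore] -/
lemma iterate_apply_head (μ : ℝ) (n : ℕ) (f : ℓ2) :
    ((⇑(Treg μ))^[n] f) 0 = ((P μ n).1 : ℂ) * f 0 + ((P μ n).2.1 : ℂ) * f 1 ∧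
    ((⇑(Treg μ))^[n] f) 1 = ((P μ n).2.1 : ℂ) * f 0 + ((P μ n).2.2 : ℂ) * f 1 := by
  induction n with
  | zero => simp
  | succ n ih =>
      obtain ⟨h0, h1⟩ := ih
      rw [Function.iterate_succ_apply']
      refine ⟨?_, ?_⟩
      · rw [Treg_apply, Tseq_zero, h0, h1, P_succ]
        have hsC := congrArg (fun x : ℝ => (x : ℂ)) (P_sym μ n)
        push_cast at hsC ⊢
        linear_combination (f 1) * hsC
      · rw [Treg_apply, Tseq_one, h0, P_succ]
        push_cast
        ring

/-- Tail coordinates of the iterates: `(Tⁿf)_{k+2} = w_kⁿ f_{k+2}`. [folklore] -/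
lemma iterate_apply_add_two (μ : ℝ) (n : ℕ) (f : ℓ2) (k : ℕ) :
    ((⇑(Treg μ))^[n] f) (k + 2) = ((wt k ^ n : ℝ) : ℂ) * f (k + 2) := by
  induction n with
  | zero => simp
  | succ n ih =>
      rw [Function.iterate_succ_apply', Treg_apply, Tseq_add_two, ih]
      push_cast
      ring

/-- **Type 1 via `e₀`, uniformly in `μ ∈ [0, 10⁻²⁴]`** ((19) of v2 p.6, with `j = n`): on the cone `Re y₀ ≥ ‖y‖/100`,
`Re⟨T_μⁿ y, y⟩ ≥ p_n|y₀|² − 2r_n|y₀||y₁| ≥ 0.96 p_n|y₀|² ≥ 0.9·10⁻⁴(q/2)ⁿ‖y‖²`, because `r_n ≤ 2·10⁻⁴p_n` and the tail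
and `s_n|y₁|²` are non-negative.  The constant `δ_n = 9·10⁻⁵(5·10⁻²¹)ⁿ` does NOT depend on `μ`. [cite: Enflo2023, v2 p.6 (19)] -/
theorem Treg_cone_bound (μ : ℝ) (hμ0 : 0 ≤ μ) (hμ1 : μ ≤ 1 / 10 ^ 24) (n : ℕ) (f : ℓ2)
    (hf : Referee.AngleCond (e 0) f) :
    9 / 10 ^ 5 * (1 / 10 ^ 20 / 2) ^ n * ‖f‖ ^ 2 ≤ ‖⟪(⇑(Treg μ))^[n] f, f⟫_ℂ‖ := by
  obtain ⟨-, hang⟩ := hf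
  rw [inner_e_left] at hang
  obtain ⟨hp, hr0, hr, hs0⟩ := P_bounds μ hμ0 n
  obtain ⟨h0, h1⟩ := iterate_apply_head μ n f
  set p := (P μ n).1 with hp_def
  set r := (P μ n).2.1 with hr_def
  set s := (P μ n).2.2 with hs_def
  have hsum := lp.summable_inner (𝕜 := ℂ) ((⇑(Treg μ))^[n] f) f
  have htail : ∑' k, ⟪((⇑(Treg μ))^[n] f) (k + 2), f (k + 2)⟫_ℂ =
      ((∑' k, wt k ^ n * ‖f (k + 2)‖ ^ 2 : ℝ) : ℂ) := by
    rw [Complex.ofReal_tsum]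
    congr 1
    funext k
    rw [iterate_apply_add_two, RCLike.inner_apply', map_mul, Complex.conj_ofReal, mul_assoc, Complex.conj_mul']
    push_cast
    ring
  have htail0 : 0 ≤ ∑' k, wt k ^ n * ‖f (k + 2)‖ ^ 2 :=
    tsum_nonneg fun k => by have := (wt_bounds k).1; positivity
  obtain ⟨w, hw_def⟩ : ∃ w : ℂ, w = (starRingEnd ℂ) (f 1) * f 0 + (starRingEnd ℂ) (f 0) * f 1 := ⟨_, rfl⟩
  have hw : ‖w‖ ≤ 2 * (‖f 0‖ * ‖f 1‖) := by
    rw [hw_def]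
    refine (norm_add_le _ _).trans (le_of_eq ?_)
    rw [norm_mul, norm_mul, RCLike.norm_conj, RCLike.norm_conj]
    ring
  have hinner : ⟪(⇑(Treg μ))^[n] f, f⟫_ℂ =
      ((p * ‖f 0‖ ^ 2 + s * ‖f 1‖ ^ 2 + ∑' k, wt k ^ n * ‖f (k + 2)‖ ^ 2 : ℝ) : ℂ) + (r : ℂ) * w := by
    rw [lp.inner_eq_tsum, tsum_split_two hsum, htail, h0, h1, RCLike.inner_apply', RCLike.inner_apply', hw_def]
    simp only [map_add, map_mul, Complex.conj_ofReal]
    push_cast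
    rw [← Complex.conj_mul' (f 0), ← Complex.conj_mul' (f 1)]
    ring
  rw [hinner]
  refine le_trans ?_ ((le_abs_self _).trans (Complex.abs_re_le_norm _))
  rw [Complex.add_re, Complex.ofReal_re, Complex.re_ofReal_mul]
  have hwre : -(2 * (‖f 0‖ * ‖f 1‖)) ≤ w.re := neg_le_of_abs_le ((Complex.abs_re_le_norm w).trans hw)
  have hf0 : 1 / 100 * ‖f‖ ≤ ‖f 0‖ := hang.trans ((le_abs_self _).trans (Complex.abs_re_le_norm _))
  have hf1 : ‖f 1‖ ≤ ‖f‖ := lp.norm_apply_le_norm (by norm_num) f 1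
  have hF0 := norm_nonneg (f 0)
  have hF1 := norm_nonneg (f 1)
  have hF := norm_nonneg f
  have hp0 : 0 ≤ p := le_trans (by positivity) hp
  have hr' : r ≤ 2 / 10 ^ 4 * p := by nlinarith
  have ha : -(2 * r * (‖f 0‖ * ‖f 1‖)) ≤ r * w.re := by
    have := mul_le_mul_of_nonneg_left hwre hr0
    linarith
  have hb : 2 * r * (‖f 0‖ * ‖f 1‖) ≤ 4 / 10 ^ 4 * p * (‖f 0‖ * ‖f‖) := by
    have h1 : ‖f 0‖ * ‖f 1‖ ≤ ‖f 0‖ * ‖f‖ := mul_le_mul_of_nonneg_left hf1 hF0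
    have h2 := mul_le_mul hr' h1 (by positivity) (by positivity)
    linarith
  have hc : p * (‖f 0‖ * ‖f‖) ≤ p * (‖f 0‖ * (100 * ‖f 0‖)) :=
    mul_le_mul_of_nonneg_left (mul_le_mul_of_nonneg_left (by linarith) hF0) hp0
  have hd : p * (1 / 100 * ‖f‖) ^ 2 ≤ p * ‖f 0‖ ^ 2 :=
    mul_le_mul_of_nonneg_left (pow_le_pow_left₀ (by positivity) hf0 2) hp0
  have he : (1 / 10 ^ 20 / 2) ^ n * ‖f‖ ^ 2 ≤ p * ‖f‖ ^ 2 := mul_le_mul_of_nonneg_right hp (by positivity)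
  have hs1 : 0 ≤ s * ‖f 1‖ ^ 2 := mul_nonneg hs0 (by positivity)
  nlinarith

/-- The uniform Type-1 constants are positive. [folklore] -/
lemma delta_pos (n : ℕ) : (0 : ℝ) < 9 / 10 ^ 5 * (1 / 10 ^ 20 / 2) ^ n := by positivity

/-- `T_μ` is of Type 1 via `u₀ = e₀` (v2 p.6), for every `μ ∈ [0, 10⁻²⁴]`, with the SAME `δ_n`. [cite: Enflo2023, v2 p.6 (19)] -/
theorem Treg_type1 (μ : ℝ) (hμ0 : 0 ≤ μ) (hμ1 : μ ≤ 1 / 10 ^ 24) : Referee.Type1 (Treg μ) :=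
  ⟨e 0, norm_e 0, fun n _ => ⟨_, delta_pos n, fun y hy => ⟨n, le_rfl, Treg_cone_bound μ hμ0 hμ1 n y hy⟩⟩⟩

/-! ### The printed Lemma 1 fails in the manuscript's regime `(εθ)₀ ≪ δ_k` -/

/-- **The printed Lemma 1 fails for `(T_μ, e₀, e₁)`, `μ = (εθ)₀/2`, for EVERY `0 < (εθ)₀ ≤ 2·10⁻²⁴`.**
`T_μ e₀ = (q/2)e₀ + μe₁`, so the lever is `⟨e₁, T_μ e₀⟩ = μ = ‖T_μ* e₁‖ < (εθ)₀ ≤ 4μ`: the printed requirement on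
`u₁` holds and `Lemma1.printed_lemma1_fails_of_lever` applies. [cite: Enflo2023, v2 p.7 (choice of u₁), pp.8–9 Lemma 1] -/
theorem printed_lemma1_fails_Treg {e₀ : ℝ} (he : 0 < e₀) (he1 : e₀ ≤ 2 / 10 ^ 24)
    (hT : ‖Treg (e₀ / 2)‖ < 1) :
    ‖adjoint (Treg (e₀ / 2)) (e 1)‖ < e₀ ∧
    ∀ (ε : ℝ) (a : ℓ2), 1 / 2 - e₀ / 10 ^ 5 < ε → ε ≤ 1 / 2 →
      IsMinimal (V (Treg (e₀ / 2)) hT (yStart (e 0))) (xStart (e 0) (e 1)) ε a →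
      e₀ / (2 * 10 ^ 5) <
        (⟪xStart (e 0) (e 1) - V (Treg (e₀ / 2)) hT (yStart (e 0)) a, V (Treg (e₀ / 2)) hT (yStart (e 0)) a⟫_ℂ).re := by
  have hμ0 : 0 ≤ e₀ / 2 := by positivity
  have hμ1 : e₀ / 2 ≤ 1 / 10 ^ 24 := by linarith
  refine ⟨by rw [norm_adjoint_Treg_e1 _ hμ0]; linarith, ?_⟩
  have hT20 : ‖Treg (e₀ / 2)‖ ≤ 1 / 10 ^ 20 := (norm_Treg _ hμ0 hμ1).le
  have hn₀ : ‖(((1 / 10 ^ 20 / 2 : ℝ)) : ℂ)‖ ≤ 1 := by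
    rw [Complex.norm_real, Real.norm_of_nonneg (by norm_num)]; norm_num
  have hm : e₀ ≤ 4 * ‖((e₀ / 2 : ℝ) : ℂ)‖ := by
    rw [Complex.norm_real, Real.norm_of_nonneg hμ0]; linarith
  exact printed_lemma1_fails_of_lever (Treg (e₀ / 2)) hT hT20 (e 0) (e 1) (norm_e 0) (norm_e 1) inner_e0_e1
    _ _ hn₀ (Treg_e0 (e₀ / 2)) he hm

/-- **Regime-faithful Type-1 counter-models to the printed Lemma 1 (packaged).**  For EVERY `(εθ)₀ ∈ (0, 2·10⁻²⁴]`
there is, on `ℓ²(ℕ)`, an operator `T` in the standing form of v2 p.1 (`‖T‖ = 10⁻²⁰`, injective, dense non-closed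
range; here also self-adjoint) which is of Type 1 via `u₀ = e₀` with the `(εθ)₀`-INDEPENDENT constants
`δ_n = 9·10⁻⁵(5·10⁻²¹)ⁿ` (`j = n` in (19)), and for which, with the orthonormal pair `u₀ = e₀`, `u₁ = e₁`, the printed
choice `‖T*u₁‖ < (εθ)₀` (p.7) holds while the printed conclusion of Lemma 1 (`εθ(ℓ'_ε) ≤ ½·10⁻⁵(εθ)₀` for some
`ε ∈ (½ − 10⁻⁵(εθ)₀, ½]`, pp.8–9) fails at EVERY radius of the window.  In particular the failure persists in the
manuscript's regime "`(εθ)` much smaller than `δ₁, δ₂, …`" (v2 p.8, p.20): the `δ_n` do not move as `(εθ)₀ → 0`.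
(Not modelled: cyclicity of `u₀` — `span{e₀,e₁}` reduces `T`.) [cite: Enflo2023, v2 p.1, p.6 (19), p.7 (choice of u₁), p.8, pp.8–9 Lemma 1, p.20] -/
theorem printed_lemma1_fails_in_regime (e₀ : ℝ) (he : 0 < e₀) (he1 : e₀ ≤ 2 / 10 ^ 24) :
    ∃ (T : ℓ2 →L[ℂ] ℓ2) (hT : ‖T‖ < 1),
      ‖T‖ = 1 / 10 ^ 20 ∧ Function.Injective T ∧ DenseRange T ∧ ¬ Function.Surjective T ∧ IsSelfAdjoint T ∧
      ‖e 0‖ = 1 ∧ ‖e 1‖ = 1 ∧ ⟪e 0, e 1⟫_ℂ = 0 ∧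
      (∀ n : ℕ, 1 ≤ n → ∀ y : ℓ2, Referee.AngleCond (e 0) y →
          9 / 10 ^ 5 * (1 / 10 ^ 20 / 2) ^ n * ‖y‖ ^ 2 ≤ ‖⟪(⇑T)^[n] y, y⟫_ℂ‖) ∧
      Referee.Type1 T ∧
      ‖adjoint T (e 1)‖ = e₀ / 2 ∧ ‖adjoint T (e 1)‖ < e₀ ∧
      ∀ (ε : ℝ) (a : ℓ2), 1 / 2 - e₀ / 10 ^ 5 < ε → ε ≤ 1 / 2 →
        IsMinimal (V T hT (yStart (e 0))) (xStart (e 0) (e 1)) ε a →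
        e₀ / (2 * 10 ^ 5) < (⟪xStart (e 0) (e 1) - V T hT (yStart (e 0)) a, V T hT (yStart (e 0)) a⟫_ℂ).re := by
  have hμ0 : 0 ≤ e₀ / 2 := by positivity
  have hμ1 : e₀ / 2 ≤ 1 / 10 ^ 24 := by linarith
  have hμ : e₀ / 2 ≠ 0 := by positivity
  have hT := norm_Treg_lt_one _ hμ0 hμ1
  obtain ⟨hadj, hfail⟩ := printed_lemma1_fails_Treg he he1 hT
  exact ⟨Treg (e₀ / 2), hT, norm_Treg _ hμ0 hμ1, Treg_injective _ hμ, Treg_denseRange _ hμ,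
    Treg_not_surjective _, Treg_isSelfAdjoint _, norm_e 0, norm_e 1, inner_e0_e1,
    fun n _ y hy => Treg_cone_bound _ hμ0 hμ1 n y hy, Treg_type1 _ hμ0 hμ1, norm_adjoint_Treg_e1 _ hμ0, hadj,
    hfail⟩

/-- **A regime-faithful instance: `(εθ)₀ = 10⁻⁶⁰`.**  Here `δ₁ = 4.5·10⁻²⁵`, `δ₂ = 2.25·10⁻⁴⁵` (and every `δ_n`,
`n ≤ 2`) exceed `(εθ)₀ = 10⁻⁶⁰` by many orders of magnitude, as v2 p.8 / p.20 require, `‖T*u₁‖ = 5·10⁻⁶¹ < (εθ)₀`,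
and the printed conclusion of Lemma 1 fails at every radius of `(½ − 10⁻⁶⁵, ½]`. [cite: Enflo2023, v2 p.8, pp.8–9 Lemma 1, p.20] -/
theorem printed_lemma1_fails_regime_instance :
    ∃ (T : ℓ2 →L[ℂ] ℓ2) (hT : ‖T‖ < 1),
      ‖T‖ = 1 / 10 ^ 20 ∧ Function.Injective T ∧ DenseRange T ∧ ¬ Function.Surjective T ∧
      (∀ y : ℓ2, Referee.AngleCond (e 0) y → 45 / 10 ^ 26 * ‖y‖ ^ 2 ≤ ‖⟪(⇑T)^[1] y, y⟫_ℂ‖) ∧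
      (∀ y : ℓ2, Referee.AngleCond (e 0) y → 225 / 10 ^ 47 * ‖y‖ ^ 2 ≤ ‖⟪(⇑T)^[2] y, y⟫_ℂ‖) ∧
      Referee.Type1 T ∧
      ‖adjoint T (e 1)‖ < 1 / 10 ^ 60 ∧
      ∀ (ε : ℝ) (a : ℓ2), 1 / 2 - (1 / 10 ^ 60) / 10 ^ 5 < ε → ε ≤ 1 / 2 →
        IsMinimal (V T hT (yStart (e 0))) (xStart (e 0) (e 1)) ε a →
        (1 / 10 ^ 60) / (2 * 10 ^ 5) <
          (⟪xStart (e 0) (e 1) - V T hT (yStart (e 0)) a, V T hT (yStart (e 0)) a⟫_ℂ).re := by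
  obtain ⟨T, hT, h1, h2, h3, h4, -, -, -, -, h9, h10, -, h12, h13⟩ :=
    printed_lemma1_fails_in_regime (1 / 10 ^ 60) (by norm_num) (by norm_num)
  refine ⟨T, hT, h1, h2, h3, h4, fun y hy => ?_, fun y hy => ?_, h10, h12, h13⟩
  · have := h9 1 le_rfl y hy
    norm_num at this ⊢
    linarith
  · have := h9 2 (by norm_num) y hy
    norm_num at this ⊢
    linarith

end Regime

end Lemma1

end Literature.Analysis.OperatorTheory.Enflo2023
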